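import Literature.Geometry.Lorentzian.KerrDeSitterSurfaceGravities
import HarnessLib

/-!
# Casals–Teixeira da Costa's superradiant thresholds on subextremal Kerr–de Sitter: the printed
# closed forms and the strict inclusions `(Ω_low, Ω_SR) ⊊ (ϖ₂, ϖ₁)` (theorems only)

Theorems only (no named facts, no new definitions). Source read verbatim: M. Casals, R. Teixeira da
Costa [CasalsTeixeiradacosta2022], arXiv:2105.13329 v3, Theorem 3.10 / 3.11:
"`|ω| ∉ |m|(0, (ϖ₂/κ₂+ϖ₀/κ₀)/(1/κ₂+1/κ₀)) ⊊ |m|(0, ϖ₁)`" and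
"`ω/m ∉ ((ϖ₁/κ₁−ϖ₀/κ₀)/(1/κ₁−1/κ₀), (ϖ₂/κ₂+ϖ₀/κ₀)/(1/κ₂+1/κ₀)) ⊊ (ϖ₂, ϖ₁)`", with the closing
identities of the proof of Theorem 3.10 (the form printed in Theorem 2):
`(ϖ₂/κ₂+ϖ₀/κ₀)/(1/κ₂+1/κ₀) = 2a/(L²Ξ − (r₀+r₂)²)`, `(ϖ₁/κ₁−ϖ₀/κ₀)/(1/κ₁−1/κ₀) = 2a/(L²Ξ − (r₀+r₁)²)`
(`L²Ξ = a² + 3/Λ`). The tree DEFINES `superradiantUpper` / `superradiantLower`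
(`KerrDeSitterPartialModeStability.lean`) by the closed forms; this file PROVES, for every
subextremal `(M, a, Λ)`:

* `superradiantUpper_eq_weighted`, `superradiantLower_eq_weighted` (`a ≠ 0`) — the two printed
  identities between the closed forms and the surface-gravity-weighted averages of the horizon
  angular velocities (via the (3.10) product forms of `KerrDeSitterSurfaceGravities.lean` and Vieta;
  `1/κ₁ − 1/κ₀ ≠ 0` by `κ₁ < κ₀`);
* the strict inclusions printed as "`⊊`", for `a > 0`:
  `horizonAngVel_rCosmo_lt_superradiantLower` (`ϖ₂ < Ω_low`),
  `superradiantLower_lt_superradiantUpper` (`Ω_low < Ω_SR`),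
  `superradiantUpper_lt_horizonAngVel_rPlus` (`Ω_SR < ϖ₁`) — by Vieta these are
  `(r₂−r₁)(r₂−r₀) > 0`, `r₂ > r₁`, `(r₁−r₀)(r₂−r₁) > 0` respectively — and
  `horizonAngVel_rCosmo_lt_rPlus` (`ϖ₂ < ϖ₁`).

So the window `|ω| < |m|Ω_SR` left open by the cited Theorem 3.10 is STRICTLY inside the
Step-1 window `|ω| < |m|ϖ₁` of `KerrDeSitterRadialEnergyIdentity.lean`, as printed.

## References
* M. Casals, R. Teixeira da Costa, Commun. Math. Phys. 394 (2022) 797–832, arXiv:2105.13329 v3,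
  Theorem 2, (3.10), Theorem 3.10/3.11 and the end of its proof. [CasalsTeixeiradacosta2022]
-/

noncomputable section

open Set

namespace Literature.Geometry.Lorentzian.KerrDeSitter

section Thresholds

variable {M a Λ : ℝ}

/-- `3/Λ = a² + s² − e₂` with `s = r₋+r₊+r_c`, `e₂ = r₋r₊+r₊r_c+r_cr₋` (the `r²`-Vieta relation solved
for `L² = 3/Λ`; private twin of the venture's `three_div_lambda_eq`).
[cite: CasalsTeixeiradacosta2022, (3.2)] -/
private theorem three_div_eq (hsub : IsSubextremal M a Λ) :
    3 / Λ = a ^ 2 + (rMinus M a Λ + rPlus M a Λ + rCosmo M a Λ) ^ 2 -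
      (rMinus M a Λ * rPlus M a Λ + rPlus M a Λ * rCosmo M a Λ + rCosmo M a Λ * rMinus M a Λ) := by
  have hv := vieta_sq hsub
  rw [div_eq_iff hsub.2.1.ne']
  linear_combination 3 * hv

/-- Vieta form of the `Ω_SR` denominator: `a² + 3/Λ − (r₋+r_c)² = 2a² + r₊² + r₊r₋ + r_c(r₊ − r₋)`.
[cite: CasalsTeixeiradacosta2022, Theorem 2] -/
private theorem upperDen_eq (hsub : IsSubextremal M a Λ) :
    a ^ 2 + 3 / Λ - (rMinus M a Λ + rCosmo M a Λ) ^ 2 =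
      2 * a ^ 2 + rPlus M a Λ ^ 2 + rPlus M a Λ * rMinus M a Λ +
        rCosmo M a Λ * (rPlus M a Λ - rMinus M a Λ) := by
  rw [three_div_eq hsub]; ring

/-- Vieta form of the `Ω_low` denominator: `a² + 3/Λ − (r₋+r₊)² = 2a² + r_c² + r_cr₋ + r₊(r_c − r₋)`.
[cite: CasalsTeixeiradacosta2022, Theorem 2] -/
private theorem lowerDen_eq (hsub : IsSubextremal M a Λ) :
    a ^ 2 + 3 / Λ - (rMinus M a Λ + rPlus M a Λ) ^ 2 =
      2 * a ^ 2 + rCosmo M a Λ ^ 2 + rCosmo M a Λ * rMinus M a Λ +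
        rPlus M a Λ * (rCosmo M a Λ - rMinus M a Λ) := by
  rw [three_div_eq hsub]; ring

/-- The `Ω_SR` denominator is positive on every subextremal Kerr–de Sitter.
[cite: CasalsTeixeiradacosta2022, Theorem 2] -/
private theorem upperDen_pos (hsub : IsSubextremal M a Λ) :
    0 < a ^ 2 + 3 / Λ - (rMinus M a Λ + rCosmo M a Λ) ^ 2 := by
  rw [upperDen_eq hsub]
  have h0 := rMinus_nonneg M a Λ
  obtain ⟨-, -, h01, h12, -⟩ := hsub
  have hy : 0 < rPlus M a Λ := lt_of_le_of_lt h0 h01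
  have hz : 0 < rCosmo M a Λ := hy.trans h12
  have h1 : 0 ≤ rPlus M a Λ * rMinus M a Λ := mul_nonneg hy.le h0
  have h2 : 0 < rCosmo M a Λ * (rPlus M a Λ - rMinus M a Λ) := mul_pos hz (by linarith)
  positivity

/-- The `Ω_low` denominator is positive on every subextremal Kerr–de Sitter.
[cite: CasalsTeixeiradacosta2022, Theorem 2] -/
private theorem lowerDen_pos (hsub : IsSubextremal M a Λ) :
    0 < a ^ 2 + 3 / Λ - (rMinus M a Λ + rPlus M a Λ) ^ 2 := by
  rw [lowerDen_eq hsub]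
  have h0 := rMinus_nonneg M a Λ
  obtain ⟨-, -, h01, h12, -⟩ := hsub
  have hy : 0 < rPlus M a Λ := lt_of_le_of_lt h0 h01
  have hz : 0 < rCosmo M a Λ := hy.trans h12
  have h1 : 0 ≤ rCosmo M a Λ * rMinus M a Λ := mul_nonneg hz.le h0
  have h2 : 0 < rPlus M a Λ * (rCosmo M a Λ - rMinus M a Λ) := mul_pos hy (by linarith)
  positivity

/-! ### The strict inclusions `(Ω_low, Ω_SR) ⊊ (ϖ₂, ϖ₁)` -/

/-- `ϖ₂ < ϖ₁` for `a > 0` (`ϖ_j = a/(r_j² + a²)`, `r₊ < r_c`). [cite: CasalsTeixeiradacosta2022, (3.10)] -/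
theorem horizonAngVel_rCosmo_lt_rPlus (hsub : IsSubextremal M a Λ) (ha : 0 < a) :
    horizonAngVel a (rCosmo M a Λ) < horizonAngVel a (rPlus M a Λ) := by
  have h0 := rMinus_nonneg M a Λ
  obtain ⟨-, -, h01, h12, -⟩ := hsub
  have hy : 0 < rPlus M a Λ := lt_of_le_of_lt h0 h01
  unfold horizonAngVel
  apply div_lt_div_of_pos_left ha (by positivity)
  nlinarith

/-- **`Ω_SR < ϖ₁`** (the printed "`|m|(0, Ω_SR) ⊊ |m|(0, ϖ₁)`"): by Vieta
`ϖ₁ − Ω_SR ∝ (r₊ − r₋)(r_c − r₊) > 0`. So the window left open by Theorem 3.10 lies strictly inside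
the Step-1 window `|ω| < |m|ϖ₁`. [cite: CasalsTeixeiradacosta2022, Theorem 3.10] -/
theorem superradiantUpper_lt_horizonAngVel_rPlus (hsub : IsSubextremal M a Λ) (ha : 0 < a) :
    superradiantUpper M a Λ < horizonAngVel a (rPlus M a Λ) := by
  have hD := upperDen_pos hsub
  have hDe := upperDen_eq hsub
  have h0 := rMinus_nonneg M a Λ
  obtain ⟨-, -, h01, h12, -⟩ := hsub
  have hy : 0 < rPlus M a Λ := lt_of_le_of_lt h0 h01
  unfold superradiantUpper horizonAngVel
  rw [div_lt_div_iff₀ hD (by positivity), hDe]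
  have key : 0 < (rPlus M a Λ - rMinus M a Λ) * (rCosmo M a Λ - rPlus M a Λ) :=
    mul_pos (by linarith) (by linarith)
  nlinarith

/-- **`ϖ₂ < Ω_low`** (the printed "`(Ω_low, Ω_SR) ⊊ (ϖ₂, ϖ₁)`", lower end): by Vieta
`Ω_low − ϖ₂ ∝ (r_c − r₊)(r_c − r₋) > 0`. [cite: CasalsTeixeiradacosta2022, Theorem 3.10] -/
theorem horizonAngVel_rCosmo_lt_superradiantLower (hsub : IsSubextremal M a Λ) (ha : 0 < a) :
    horizonAngVel a (rCosmo M a Λ) < superradiantLower M a Λ := by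
  have hD := lowerDen_pos hsub
  have hDe := lowerDen_eq hsub
  have h0 := rMinus_nonneg M a Λ
  obtain ⟨-, -, h01, h12, -⟩ := hsub
  have hy : 0 < rPlus M a Λ := lt_of_le_of_lt h0 h01
  have hz : 0 < rCosmo M a Λ := hy.trans h12
  unfold superradiantLower horizonAngVel
  rw [div_lt_div_iff₀ (by positivity) hD, hDe]
  have key : 0 < (rCosmo M a Λ - rPlus M a Λ) * (rCosmo M a Λ - rMinus M a Λ) :=
    mul_pos (by linarith) (by linarith)
  nlinarith

/-- **`Ω_low < Ω_SR`** (the printed interval is non-empty): the two denominators differ by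
`(r₋+r_c)² − (r₋+r₊)² > 0`. [cite: CasalsTeixeiradacosta2022, Theorem 3.10] -/
theorem superradiantLower_lt_superradiantUpper (hsub : IsSubextremal M a Λ) (ha : 0 < a) :
    superradiantLower M a Λ < superradiantUpper M a Λ := by
  have hDu := upperDen_pos hsub
  have hDl := lowerDen_pos hsub
  have h0 := rMinus_nonneg M a Λ
  obtain ⟨-, -, h01, h12, -⟩ := hsub
  unfold superradiantLower superradiantUpper
  apply div_lt_div_of_pos_left (by linarith) hDu
  nlinarith

/-- Hence `0 < Ω_low < Ω_SR < ϖ₁` and `ϖ₂ < Ω_low` on every subextremal Kerr–de Sitter with `a > 0`: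
the chain of the printed strict inclusions. [cite: CasalsTeixeiradacosta2022, Theorem 3.10] -/
theorem superradiant_chain (hsub : IsSubextremal M a Λ) (ha : 0 < a) :
    0 < horizonAngVel a (rCosmo M a Λ) ∧
      horizonAngVel a (rCosmo M a Λ) < superradiantLower M a Λ ∧
      superradiantLower M a Λ < superradiantUpper M a Λ ∧
      superradiantUpper M a Λ < horizonAngVel a (rPlus M a Λ) := by
  refine ⟨?_, horizonAngVel_rCosmo_lt_superradiantLower hsub ha,
    superradiantLower_lt_superradiantUpper hsub ha, superradiantUpper_lt_horizonAngVel_rPlus hsub ha⟩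
  unfold horizonAngVel
  positivity

/-! ### The printed closed forms = the surface-gravity-weighted averages -/

/-- **`(ϖ₂/κ₂ + ϖ₀/κ₀)/(1/κ₂ + 1/κ₀) = 2a/(a² + 3/Λ − (r₀+r₂)²)`** — the identity printed at the end of
the proof of Theorem 3.10 (and used as the form of Theorem 2), for every subextremal Kerr–de Sitter
with `a ≠ 0`: with the (3.10) product forms `κ₀ = (Λ/3)N₀/(2Ξ(r₀²+a²))`, `κ₂ = (Λ/3)N₂/(2Ξ(r₂²+a²))`,
`N₀ = (r₁−r₀)(r₂−r₀)(2r₀+r₁+r₂)`, `N₂ = (r₂−r₀)(r₂−r₁)(r₀+r₁+2r₂)`, one has `N₀ + N₂ = 2(r₂−r₀)²(r₂+r₀)`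
and the identity reduces, by Vieta, to a polynomial identity in the roots.
[cite: CasalsTeixeiradacosta2022, Theorem 3.10 (proof, closing identities)] -/
theorem superradiantUpper_eq_weighted (hsub : IsSubextremal M a Λ) (ha : a ≠ 0) :
    (horizonAngVel a (rCosmo M a Λ) / surfaceGravity M a Λ (rCosmo M a Λ) +
        horizonAngVel a (rMinus M a Λ) / surfaceGravity M a Λ (rMinus M a Λ)) /
      (1 / surfaceGravity M a Λ (rCosmo M a Λ) + 1 / surfaceGravity M a Λ (rMinus M a Λ)) =
      superradiantUpper M a Λ := by
  have hκ0 := surfaceGravity_rMinus_pos hsub ha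
  have hκ2 := surfaceGravity_rCosmo_pos hsub
  have hD := upperDen_pos hsub
  have hDe := upperDen_eq hsub
  have hx := rMinus_pos hsub ha
  rw [surfaceGravity_rMinus_eq hsub, surfaceGravity_rCosmo_eq hsub] at *
  obtain ⟨hM, hΛ, h01, h12, -⟩ := hsub
  have hξ := xi_pos hΛ.le a
  unfold superradiantUpper horizonAngVel
  rw [hDe]
  set x := rMinus M a Λ
  set y := rPlus M a Λ
  set z := rCosmo M a Λ
  have hy : 0 < y := hx.trans h01
  have hz : 0 < z := hy.trans h12
  -- the (3.10) numerators `N₀`, `N₂` as atoms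
  set n0 := Λ / 3 * (y - x) * (z - x) * (2 * x + y + z) with hn0
  set n2 := Λ / 3 * (z - x) * (z - y) * (x + y + 2 * z) with hn2
  have ha2 : 0 < a ^ 2 := by positivity
  have hΛ3 : 0 < Λ / 3 := by positivity
  have hN0 : 0 < n0 := mul_pos (mul_pos (mul_pos hΛ3 (by linarith)) (by linarith)) (by linarith)
  have hN2 : 0 < n2 := mul_pos (mul_pos (mul_pos hΛ3 (by linarith)) (by linarith)) (by linarith)
  have hn0' : n0 ≠ 0 := hN0.ne'
  have hn2' : n2 ≠ 0 := hN2.ne'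
  have hξ0 : xi a Λ ≠ 0 := hξ.ne'
  have hxa : x ^ 2 + a ^ 2 ≠ 0 := by positivity
  have hza : z ^ 2 + a ^ 2 ≠ 0 := by positivity
  have hden2 : 0 < 2 * a ^ 2 + y ^ 2 + y * x + z * (y - x) := by
    have h1 : 0 < y * x := mul_pos hy hx
    have h2 : 0 < z * (y - x) := mul_pos hz (by linarith)
    positivity
  have hd2 : 2 * a ^ 2 + y ^ 2 + y * x + z * (y - x) ≠ 0 := hden2.ne'
  have hsum : 1 / (n2 / (2 * xi a Λ * (z ^ 2 + a ^ 2))) +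
      1 / (n0 / (2 * xi a Λ * (x ^ 2 + a ^ 2))) ≠ 0 := by
    have : 0 < 1 / (n2 / (2 * xi a Λ * (z ^ 2 + a ^ 2))) +
        1 / (n0 / (2 * xi a Λ * (x ^ 2 + a ^ 2))) := by positivity
    exact this.ne'
  rw [div_eq_div_iff hsum hd2]
  field_simp
  rw [hn0, hn2]
  ring

/-- **`(ϖ₁/κ₁ − ϖ₀/κ₀)/(1/κ₁ − 1/κ₀) = 2a/(a² + 3/Λ − (r₀+r₁)²)`** — the second printed closing identity
(the lower real-axis threshold of Theorem 3.10 / Theorem 2), for every subextremal Kerr–de Sitter with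
`a ≠ 0` (`1/κ₁ − 1/κ₀ > 0` by `surfaceGravity_rPlus_lt_rMinus`); `N₁ − N₀ = 2(r₁−r₀)²(r₀+r₁)` with
`N₁ = (r₁−r₀)(r₂−r₁)(r₀+2r₁+r₂)`. [cite: CasalsTeixeiradacosta2022, Theorem 3.10 (proof, closing identities)] -/
theorem superradiantLower_eq_weighted (hsub : IsSubextremal M a Λ) (ha : a ≠ 0) :
    (horizonAngVel a (rPlus M a Λ) / surfaceGravity M a Λ (rPlus M a Λ) -
        horizonAngVel a (rMinus M a Λ) / surfaceGravity M a Λ (rMinus M a Λ)) /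
      (1 / surfaceGravity M a Λ (rPlus M a Λ) - 1 / surfaceGravity M a Λ (rMinus M a Λ)) =
      superradiantLower M a Λ := by
  have hκ0 := surfaceGravity_rMinus_pos hsub ha
  have hκ1 := surfaceGravity_rPlus_pos hsub
  have hlt := surfaceGravity_rPlus_lt_rMinus hsub ha
  have hD := lowerDen_pos hsub
  have hDe := lowerDen_eq hsub
  have hx := rMinus_pos hsub ha
  have hne : 1 / surfaceGravity M a Λ (rPlus M a Λ) - 1 / surfaceGravity M a Λ (rMinus M a Λ) ≠ 0 := by
    have : 1 / surfaceGravity M a Λ (rMinus M a Λ) < 1 / surfaceGravity M a Λ (rPlus M a Λ) :=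
      one_div_lt_one_div_of_lt hκ1 hlt
    linarith
  rw [surfaceGravity_rMinus_eq hsub, surfaceGravity_rPlus_eq hsub] at *
  obtain ⟨hM, hΛ, h01, h12, -⟩ := hsub
  have hξ := xi_pos hΛ.le a
  unfold superradiantLower horizonAngVel
  rw [hDe]
  set x := rMinus M a Λ
  set y := rPlus M a Λ
  set z := rCosmo M a Λ
  have hy : 0 < y := hx.trans h01
  have hz : 0 < z := hy.trans h12
  -- the (3.10) numerators `N₀`, `N₁` as atoms
  set n0 := Λ / 3 * (y - x) * (z - x) * (2 * x + y + z) with hn0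
  set n1 := Λ / 3 * (y - x) * (z - y) * (x + 2 * y + z) with hn1
  have ha2 : 0 < a ^ 2 := by positivity
  have hΛ3 : 0 < Λ / 3 := by positivity
  have hN0 : 0 < n0 := mul_pos (mul_pos (mul_pos hΛ3 (by linarith)) (by linarith)) (by linarith)
  have hN1 : 0 < n1 := mul_pos (mul_pos (mul_pos hΛ3 (by linarith)) (by linarith)) (by linarith)
  have hn0' : n0 ≠ 0 := hN0.ne'
  have hn1' : n1 ≠ 0 := hN1.ne'
  have hξ0 : xi a Λ ≠ 0 := hξ.ne'
  have hxa : x ^ 2 + a ^ 2 ≠ 0 := by positivity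
  have hya : y ^ 2 + a ^ 2 ≠ 0 := by positivity
  have hden2 : 0 < 2 * a ^ 2 + z ^ 2 + z * x + y * (z - x) := by
    have h1 : 0 < z * x := mul_pos hz hx
    have h2 : 0 < y * (z - x) := mul_pos hy (by linarith)
    positivity
  have hd2 : 2 * a ^ 2 + z ^ 2 + z * x + y * (z - x) ≠ 0 := hden2.ne'
  rw [div_eq_div_iff hne hd2]
  field_simp
  rw [hn0, hn1]
  ring

end Thresholds

end Literature.Geometry.Lorentzian.KerrDeSitter

end
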